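import Summits.Ventures.HodgeRepro2.T5SU11JacobiJointLawRate

/-!
# The rates of the marginal limit laws of the orbit radius and of the Cartan coordinate, uniformly in `0 ≤ λ ≤ 2`

`T5SU11JacobiOrbitLawAsymptotic` and `T5SU11JacobiCartanLawAsymptotic` prove `P_{k,λ}(k|g·0|²/2 > y) → e^{−y}` and
`P_{k,λ}(k t(g)²/2 > z) → e^{−z}`. This file makes both quantitative for `0 ≤ λ ≤ 2`:

* the orbit radius: the joint event of `T5SU11JacobiJointLawRate` at `x = 0`, `z = 0` IS the orbit-radius event
  (`setOf_orbit_gt_eq_joint`: `|g·0|² > 2y/k` forces `log|a| > 0` and `t > 0`), so the joint rate gives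
  **`|P_{k,λ}(k|g·0|²/2 > y) − e^{−y}| ≤ (5y² + 3y + 2)/k`** for `k ≥ max(4, 4y)`, `y > 0` (`abs_orbit_tail_prob_sub_exp_le`);
* the Cartan coordinate: the event is `{log cosh √(2z/k) < log|a|}` with `z/(k + z) ≤ log cosh √(2z/k) ≤ z/k`, so the
  general-threshold rate of `T5SU11JacobiPhaseLawRate` and `|e^{−A} − e^{−B}| ≤ |A − B|` give
  **`|P_{k,λ}(k t² /2 > z) − e^{−z}| ≤ (z² + 3z + 2)/k`** for `k ≥ 4`, `z ≥ 0` (`abs_cartan_tail_prob_sub_exp_le`).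

Together with `T5SU11JacobiPhaseLawRateScaled` (the phase, `(2 + 3x) e^{−x/2}/k`) all three coordinates of the
near-identity concentration of the explicit model converge to `Exp(1)` at the rate `1/k`, uniformly in
`λ ∈ [0, 2]`. Nothing is claimed about (N).

Blind lane: Mathlib + the HodgeRepro2 prefix only; no sorry; axioms ⊆ {propext, Classical.choice,
Quot.sound}.
-/

namespace Summit.Ventures.HodgeRepro2.T5SU11JacobiMarginalLawRate

open MeasureTheory MeasureTheory.Measure Metric Set Filter Topology
open T5SU11Unimodular T5SU11Fibration T5SU11Cartan T5SU11OneParameter T5SU11CartanProjection T5HaarCircle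
  T5BergmanCoefficient T5SU11FibrationHaar T5SU11SphericalFunction T5SU11SphericalSymmetry
  T5SU11SphericalBounds T5SU11SphericalContinuous T5SU11JacobiIwasawa T5SU11JacobiTransform
  T5SU11JacobiWeight T5SU11KFiniteMajorantPow T5SU11JacobiLaplacePhase T5SU11JacobiPhaseTailGroup
  T5SU11PhaseTail T5SU11PhaseTailCartan T5SU11OrbitRadiusLaw T5SU11JacobiCartanLawAsymptotic
  T5SU11JacobiJointLawAsymptotic T5SU11JacobiPhaseLawRate T5SU11JacobiPhaseLawRateScaled
  T5SU11JacobiJointLawRate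
open scoped Real

/-! ### The orbit-radius event is the joint event at `x = 0`, `z = 0` -/

/-- `{2y/k < |g·0|²} = {0/k < log|a|} ∩ {2y/k < |g·0|²} ∩ {√(2·0/k) < t}` for `0 < 2y/k < 1`. -/
theorem setOf_orbit_gt_eq_joint {y k : ℝ} (hy : 0 < y) (hk : 2 * y < k) :
    {g : SU11 | 2 * y / k < ‖orbit g‖ ^ 2}
      = {g : SU11 | 0 / k < Real.log ‖mat g 0 0‖ ∧ 2 * y / k < ‖orbit g‖ ^ 2 ∧
          Real.sqrt (2 * 0 / k) < cartanT g} := by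
  have hk0 : 0 < k := by linarith
  have hu0 : 0 < 2 * y / k := by positivity
  have hu1 : 2 * y / k < 1 := by rw [div_lt_one hk0]; exact hk
  ext g
  simp only [mem_setOf_eq, zero_div, mul_zero, Real.sqrt_zero]
  constructor
  · intro h
    have h1 := Set.ext_iff.mp (setOf_norm_orbit_sq_gt_eq hu1) g
    simp only [mem_setOf_eq] at h1
    have hlog : -(1 / 2) * Real.log (1 - 2 * y / k) < Real.log ‖mat g 0 0‖ := h1.mp h
    have hpos : 0 < -(1 / 2) * Real.log (1 - 2 * y / k) := by
      have : Real.log (1 - 2 * y / k) < 0 := Real.log_neg (by linarith) (by linarith)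
      linarith
    have h2 := Set.ext_iff.mp (setOf_cartanT_gt_eq (le_refl (0 : ℝ))) g
    simp only [mem_setOf_eq, Real.cosh_zero, Real.log_one] at h2
    exact ⟨by linarith, h, h2.mpr (by linarith)⟩
  · exact fun h => h.2.1

/-! ### The Cartan coordinate -/

/-- The Cartan threshold: `z/(k + z) ≤ log cosh √(2z/k) ≤ z/k` for `k > 0`, `z ≥ 0`. -/
theorem cartan_threshold_bounds {z k : ℝ} (hk : 0 < k) (hz : 0 ≤ z) :
    z / (k + z) ≤ Real.log (Real.cosh (Real.sqrt (2 * z / k)))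
      ∧ Real.log (Real.cosh (Real.sqrt (2 * z / k))) ≤ z / k := by
  have hsq : Real.sqrt (2 * z / k) ^ 2 = 2 * z / k := Real.sq_sqrt (by positivity)
  have hl := le_log_cosh (Real.sqrt_nonneg (2 * z / k))
  have hu := log_cosh_le (Real.sqrt (2 * z / k))
  rw [hsq] at hl hu
  have e1 : (2 * z / k / 2) / (1 + 2 * z / k / 2) = z / (k + z) := by
    have : k + z ≠ 0 := by linarith
    field_simp
  have e2 : 2 * z / k / 2 = z / k := by ring
  rw [e1] at hl
  rw [e2] at hu
  exact ⟨hl, hu⟩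

section measure

variable [MeasurableSpace Circle] [BorelSpace Circle]

/-- **THE RATE OF THE ORBIT-RADIUS LIMIT LAW, UNIFORMLY IN `0 ≤ λ ≤ 2`**: for `k ≥ 4`, `k ≥ 4y`, `y > 0`,
`|P_{k,λ}(k|g·0|²/2 > y) − e^{−y}| ≤ (5y² + 3y + 2)/k`. -/
theorem abs_orbit_tail_prob_sub_exp_le {k lam y : ℝ} (hk : 4 ≤ k) (hky : 4 * y ≤ k) (h0 : 0 ≤ lam)
    (h2 : lam ≤ 2) (hy : 0 < y) :
    |(∫ g in {g : SU11 | 2 * y / k < ‖orbit g‖ ^ 2},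
          (1 - ‖orbit g‖ ^ 2) ^ (k / 2) * sph lam g ∂(nu haarCircle))
        / (∫ g, (1 - ‖orbit g‖ ^ 2) ^ (k / 2) * sph lam g ∂(nu haarCircle)) - Real.exp (-y)|
      ≤ (5 * y ^ 2 + 3 * y + 2) / k := by
  have h := abs_joint_tail_prob_sub_exp_le (k := k) (lam := lam) (x := 0) (y := y) (z := 0) hk hky h0 h2
    le_rfl hy le_rfl
  rw [setOf_orbit_gt_eq_joint hy (by linarith)]
  have hmax : max (0 : ℝ) (max y 0) = y := by
    rw [max_eq_left hy.le, max_eq_right hy.le]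
  rwa [hmax] at h

/-- **THE RATE OF THE CARTAN-COORDINATE LIMIT LAW, UNIFORMLY IN `0 ≤ λ ≤ 2`**: for `k ≥ 4`, `z ≥ 0`,
`|P_{k,λ}(k t(g)²/2 > z) − e^{−z}| ≤ (z² + 3z + 2)/k`. -/
theorem abs_cartan_tail_prob_sub_exp_le {k lam z : ℝ} (hk : 4 ≤ k) (h0 : 0 ≤ lam) (h2 : lam ≤ 2)
    (hz : 0 ≤ z) :
    |(∫ g in {g : SU11 | Real.sqrt (2 * z / k) < cartanT g},
          (1 - ‖orbit g‖ ^ 2) ^ (k / 2) * sph lam g ∂(nu haarCircle))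
        / (∫ g, (1 - ‖orbit g‖ ^ 2) ^ (k / 2) * sph lam g ∂(nu haarCircle)) - Real.exp (-z)|
      ≤ (z ^ 2 + 3 * z + 2) / k := by
  have hk0 : 0 < k := by linarith
  have hr : 0 < k - 2 := by linarith
  set τ : ℝ := Real.log (Real.cosh (Real.sqrt (2 * z / k))) with hτ
  obtain ⟨hτl, hτu⟩ := cartan_threshold_bounds hk0 hz
  have hτ0 : 0 ≤ τ := le_trans (by positivity) hτl
  rw [setOf_cartanT_gt_eq (Real.sqrt_nonneg _), ← hτ]
  have hrate := abs_phase_tail_prob_sub_exp_le' (k := k) (lam := lam) (t := τ) (by linarith) h0 h2 hτ0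
  have hexp : |Real.exp (-((k - 2) * τ)) - Real.exp (-z)| ≤ |(k - 2) * τ - z| :=
    abs_exp_neg_sub_exp_neg_le (by positivity) hz
  -- the threshold deficit: `z − z(z + 2)/k ≤ (k − 2)τ ≤ z`
  have hthr : |(k - 2) * τ - z| ≤ z * (z + 2) / k := by
    rw [abs_le]
    constructor
    · have hkz : 0 < k + z := by linarith
      have e : (k - 2) * (z / (k + z)) = z - z * (z + 2) / (k + z) := by
        field_simp
        ring
      have h1 : z * (z + 2) / (k + z) ≤ z * (z + 2) / k :=
        div_le_div_of_nonneg_left (by positivity) hk0 (by linarith)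
      have h3 : (k - 2) * (z / (k + z)) ≤ (k - 2) * τ := mul_le_mul_of_nonneg_left hτl hr.le
      linarith
    · have h3 : (k - 2) * τ ≤ (k - 2) * (z / k) := mul_le_mul_of_nonneg_left hτu hr.le
      have e : (k - 2) * (z / k) = z - 2 * z / k := by field_simp
      have : 0 ≤ 2 * z / k := by positivity
      have : 0 ≤ z * (z + 2) / k := by positivity
      linarith
  -- the first term: `c(τ + 2/(k−2)) e^{−(k−2)τ} ≤ (z + 4)/(2k)`
  have hc : lam * (2 - lam) / 2 ≤ 1 / 2 := by nlinarith [sq_nonneg (lam - 1)]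
  have hc0 : 0 ≤ lam * (2 - lam) / 2 := by nlinarith
  have hinv : 2 / (k - 2) ≤ 4 / k := by
    rw [div_le_div_iff₀ hr hk0]
    linarith
  have hfirst : lam * (2 - lam) / 2 * (τ + 2 / (k - 2)) * Real.exp (-((k - 2) * τ)) ≤ (z + 4) / (2 * k) := by
    have he : Real.exp (-((k - 2) * τ)) ≤ 1 := Real.exp_le_one_iff.mpr (by nlinarith)
    calc lam * (2 - lam) / 2 * (τ + 2 / (k - 2)) * Real.exp (-((k - 2) * τ))
        ≤ 1 / 2 * (z / k + 4 / k) * 1 := by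
          apply mul_le_mul _ he (Real.exp_pos _).le (by positivity)
          exact mul_le_mul hc (by linarith) (by positivity) (by norm_num)
      _ = (z + 4) / (2 * k) := by ring
  have hsum : (z + 4) / (2 * k) + z * (z + 2) / k ≤ (z ^ 2 + 3 * z + 2) / k := by
    rw [show (z + 4) / (2 * k) + z * (z + 2) / k = (z / 2 + 2 + z * (z + 2)) / k by field_simp; ring]
    apply div_le_div_of_nonneg_right _ hk0.le
    nlinarith
  calc |(∫ g in {g : SU11 | τ < Real.log ‖mat g 0 0‖},
          (1 - ‖orbit g‖ ^ 2) ^ (k / 2) * sph lam g ∂(nu haarCircle))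
        / (∫ g, (1 - ‖orbit g‖ ^ 2) ^ (k / 2) * sph lam g ∂(nu haarCircle)) - Real.exp (-z)|
      = |((∫ g in {g : SU11 | τ < Real.log ‖mat g 0 0‖},
            (1 - ‖orbit g‖ ^ 2) ^ (k / 2) * sph lam g ∂(nu haarCircle))
          / (∫ g, (1 - ‖orbit g‖ ^ 2) ^ (k / 2) * sph lam g ∂(nu haarCircle))
            - Real.exp (-((k - 2) * τ))) + (Real.exp (-((k - 2) * τ)) - Real.exp (-z))| := by
        congr 1
        ring
    _ ≤ |(∫ g in {g : SU11 | τ < Real.log ‖mat g 0 0‖},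
            (1 - ‖orbit g‖ ^ 2) ^ (k / 2) * sph lam g ∂(nu haarCircle))
          / (∫ g, (1 - ‖orbit g‖ ^ 2) ^ (k / 2) * sph lam g ∂(nu haarCircle))
            - Real.exp (-((k - 2) * τ))| + |Real.exp (-((k - 2) * τ)) - Real.exp (-z)| :=
        abs_add_le _ _
    _ ≤ (z + 4) / (2 * k) + z * (z + 2) / k := by
        gcongr
        · exact hrate.trans hfirst
        · exact hexp.trans hthr
    _ ≤ (z ^ 2 + 3 * z + 2) / k := hsum

end measure

end Summit.Ventures.HodgeRepro2.T5SU11JacobiMarginalLawRate
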